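import Literature.MathematicalPhysics.QuantumFieldTheory.Balaban1983to89.Node00.TorusCoverCubeMemberPrintZd
import Literature.MathematicalPhysics.QuantumFieldTheory.Balaban1983to89.Node00.TorusCoverCubeDomains
import Literature.MathematicalPhysics.QuantumFieldTheory.Balaban1983to89.B8Eq131CubesRecDictionary

/-!
# NODE 00 — THE PRINT DATUM OF A GRID CUBE AS A RECORD DATUM `Node00.CubeB8DZ` WITH THE TOP DENTED BY THE RUN's REGION: `recordCubePZ` — [15] (148)–(150) AS PRINTED
# («`Ω′_j = □_j`, `j < k`; `Ω′_k = □_k ∩ Ω_k`»), the dented twin of STAGE 3a's `propCubePZ` (whose dent is empty)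

Cell `pub-ymgap`, width seat `pub-ymgap-dag-n07-w3` g13 (junction side of the K0 road).  `--kind definition --supports stmt-QuantumFields-20541` (K0⁷; count-neutral).  TWO `def`s
(`dentFamZ`, `recordCubePZ`) + set bookkeeping; NO estimate.  [15] = [Balaban1985Variational]; [6] = [Balaban1985RegularSpaces]; [II] = [Balaban1984PropagatorsII]; [I] = [Balaban1987RG1].

WHY (⚑ LOCATED-TOP-DENT, cell bus 2026-08-29 I.30757, Q1 answered YES by dag-n07-e I.30862).  The premise of record's row 9′ (`NrmSymPhiOfRecord`, φ-b₂ ∕ `Ψ ε j` editions) is read by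
the chart at the level-`(j−1)` cells of `D″ = domainsMeet (cubeDomains …) (domainsOfSeq s.Ω j hk)`, including the DENT PAIRS whose blocks lie in `π″□_j ∖ Ω_j`.  `D″` is print's dented
tower (148)–(150): `Ω′_{j′} = □_{j′}` below the top (the knit's collar «`π(□̃) ⊆ Ω_{j−1}`»), `Ω′_j = □_j ∩ Ω_j` at the top.  STAGE 3a's `propCubePZ` instantiates the record crown over the
CONSTANT family «`Ω′ ≡ □̃ᶻ`» — EMPTY dent — so its (1.29) cells at level `j−1` exclude every site under `□_j`, and NO normalisation is delivered at the dent pairs (a first-order hole for the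
junction).  THIS FILE types the instance WITH THE TOP DENT: the ambient family `dentFamZ` is `□̃ᶻ` at every level except the top, where it is `□̃ᶻ ∩` (the top-anchored `ℤᵈ` lift of a
level-`n` site set `Dtop`, e.g. `(domainsOfSeq s.Ω n hk).Om n`); the lift is saturated for the CENTRED `Lⁿ`-blocks (the cover sends the centred block of `x` anchored at `c_n·𝟙` onto the
torus block `π_n(⌊(x + c_n·𝟙)∕Lⁿ⌋)`), so `CubeB8DZ.blocks` holds; «`□̃ ⊂ Ω′_{n−1}`» is `rfl` below the top.  dag-n05-e's record crown (R8, and g42's pre-composed F1–F8) is generic in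
`c : CubeB8DZ d L K Ω`, so it applies to `recordCubePZ` verbatim; its dent premise (saturation for the `L^{s+1}·Lⁿ` superblocks anchored at `Lⁿ(c.a − c.ρ) − c_n·𝟙`) is NOT discharged
here (Q2′ on the bus: it holds iff the run's region cubes, of side `Lⁿ·M·R_n`, satisfy `L^{s+1} ∣ M·R_n`).

WHAT IS DECLARED ∕ PROVED (kernel; `Params`, odd `L`).
§1 `liftTopZ P n Dtop` (the anchored lift `{x : iterBlockOf n (π(x + c_n·𝟙)) ∈ Dtop}`), `blockMap_pow_add_ctrShift_eq_of_flmZ_eq` (centred blocks ↦ corner labels), ★ `liftTopZ_blocks_flmZ`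
   (centred `Lⁿ`-block saturation of the lift), `mem_liftTopZ_iff`.
§2 `dentFamZ P n M ρ a Dtop` (the ambient family), `dentFamZ_of_ne` ∕ `dentFamZ_top`, ★★ `recordCubePZ P n hn hnK M ρ hρ a Dtop : CubeB8DZ P.d P.L n (dentFamZ …)` (scale `n`, corner
   `cornerP`, side `sideP`, collar `ρ`; `tcube_sub` = `rfl` below the top; `blocks` = §1 ∩ `tcubeZ_blocks_flmZ`), projections `recordCubePZ_k ∕ _a ∕ _M ∕ _ρ`,
   ★ `recordCubePZ_sq_of_lt` (below the top the dented tower IS `propCubePZ`'s: `(recordCubePZ …).sq j′ = (propCubePZ …).sq j′` for `j′ < n`), ★ `recordCubePZ_sq_top`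
   (`= cubeZ … n n ∩ liftTopZ …` — the dent).
HONEST FRAMING: count-neutral; two definitions + set bookkeeping; NO estimate of [6]∕[15]∕[I]; the R8 dent premise, the (1.29)-cell ↔ `D″`-cell dictionary and the φ-row are NOT here;
`HThm4RecSym152Phi(E)` ∕ `HThm4Rec*` UNDISCHARGED; N05 ∕ N07 NOT discharged; K0⁷ ∕ K1⁹ NOT closed; counts unmoved; one finite 𝕋⁴ programme at fixed ε — R4 closes the conditional finite-𝕋⁴
rung `BalabanLadder.UV` only; the YM mass gap (Clay) is NOT proved by any of this; nothing continuum ∕ ℝ⁴ ∕ OS.  No `sorry`, no `instance`, no `notation`.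

References: [15] (144) p. 300, (148)–(150) p. 301; [6] p. 98 («□̃»), (1.3)–(1.6) p. 77, (1.130)–(1.131) p. 99; [II] (2.1)–(2.3) p. 224; [I] (0.1) p. 251, (0.3)–(0.4) pp. 252–253.
-/

noncomputable section

namespace Literature.MathematicalPhysics.QuantumFieldTheory.Balaban1983to89.Node00

open scoped Matrix.Norms.L2Operator
open Literature.MathematicalPhysics.QuantumLattice (blockMap)
open B7Prop1Local (InBox)
open BlockAveragingZd (ctrShift)
open B8Eq131Cubes (tLo tHi ctr gs cube tcube flm under_flm)
open B8Eq131CubesRec (boxZ cubeZ tcubeZ bLoZ bHiZ sqLoZ sqHiZ)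
open B8Eq131CubesRecDictionary (flm_add_ctrShift_self)
open B8Eq131CubesAdmissibleRec (cubeFamZ)
open B8Eq119TwistedAxialRec (UnderZ flmZ underZ_flmZ underZ_iff_flmZ_eq)
open B15Eq112TorusCover (cover)
open B14DomainGeom (Pt)
open B5Eq118OneStroke (iterBlockOf)

variable {P : Params}

/-! ## §1  The top-anchored `ℤᵈ` lift of a level-`n` site set and its centred block law -/

section Lift

variable (P)

/-- **THE ANCHORED LIFT OF A LEVEL-`n` SITE SET**: the fine `ℤᵈ` sites (crown coordinates, torus label `x + c_n·𝟙`) whose level-`n` torus block lies in `Dtop` — for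
`Dtop := (domainsOfSeq s.Ω n hk).Om n` this is the lift of the run's top region `Ω_n` (as `n`-blocks). [cite: Balaban1985RegularSpaces, (1.3)–(1.4) p.77; Balaban1987RG1, (0.1) p.251, (0.3) p.252] -/
def liftTopZ (n : ℕ) (Dtop : Finset (Site P n)) : Set (Pt P.d) :=
  {x | iterBlockOf n (cover P (x + fun _ => ((ctrShift P.L n : ℕ) : ℤ))) ∈ Dtop}

variable {P}

/-- Membership in the lift. [cite: Balaban1987RG1, (0.3) p.252 (bookkeeping)] -/
theorem mem_liftTopZ_iff (n : ℕ) (Dtop : Finset (Site P n)) (x : Pt P.d) :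
    x ∈ liftTopZ P n Dtop ↔ iterBlockOf n (cover P (x + fun _ => ((ctrShift P.L n : ℕ) : ℤ))) ∈ Dtop := Iff.rfl

/-- The corner label of the anchored site is the centred block label: `⌊(x + c_n·𝟙)∕Lⁿ⌋ = flmZ L n x` (odd `L`). [cite: Balaban1987RG1, (0.3) p.252; Balaban1985RegularSpaces, (1.4) p.77] -/
theorem blockMap_pow_add_ctrShift (n : ℕ) (x : Pt P.d) : blockMap (P.L ^ n) (x + fun _ => ((ctrShift P.L n : ℕ) : ℤ)) = flmZ P.L n x := by
  have h1 : B8Ineq132.Under P.L n (flm P.L n (x + fun _ => ((ctrShift P.L n : ℕ) : ℤ))) (x + fun _ => ((ctrShift P.L n : ℕ) : ℤ)) := under_flm P.hL.2.le n _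
  rw [(under_iff_blockMap_eq n _ _).1 h1, flm_add_ctrShift_self P.hL.1]

/-- ★ **THE LIFT IS A UNION OF CENTRED `Lⁿ`-BLOCKS** (`n ≤ m + K`): `flmZ L n x = flmZ L n y → x ∈ liftTopZ … → y ∈ liftTopZ …` — the field `CubeB8DZ.blocks` for the dent.
[cite: Balaban1985RegularSpaces, (1.3) p.77 («Ω_j = Bʲ(Ω_j^{(j)})»); Balaban1987RG1, (0.1) p.251, (0.3) p.252] -/
theorem liftTopZ_blocks_flmZ {n : ℕ} (hn : n ≤ P.m + P.K) (Dtop : Finset (Site P n)) ⦃x y : Pt P.d⦄ (h : flmZ P.L n x = flmZ P.L n y)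
    (hx : x ∈ liftTopZ P n Dtop) : y ∈ liftTopZ P n Dtop := by
  rw [mem_liftTopZ_iff, iterBlockOf_cover hn, blockMap_pow_add_ctrShift] at hx ⊢
  rwa [← h]

end Lift

/-! ## §2  The dented record datum -/

section Datum

variable (P)

/-- **THE AMBIENT FAMILY WITH A TOP DENT**: `□̃ᶻ` at every level except `n`, where it is `□̃ᶻ ∩ liftTopZ P n Dtop` ([15] (148)–(150): «`Ω′_j = □_j` for `j < k`», the top intersected
with the run's region; only levels `n − 1` and `n` are read by `CubeB8DZ`). [cite: Balaban1985Variational, (148)–(150) p.301; Balaban1985RegularSpaces, p.98] -/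
def dentFamZ (n M ρ : ℕ) (a : Pt P.d) (Dtop : Finset (Site P n)) : ℕ → Set (Pt P.d) := fun i =>
  if i = n then tcubeZ P.L (cornerP P M ρ a) (sideP P M ρ) ρ n ∩ liftTopZ P n Dtop else tcubeZ P.L (cornerP P M ρ a) (sideP P M ρ) ρ n

variable {P}

/-- Below (or above) the top the family is `□̃ᶻ`. [cite: Balaban1985Variational, (148) p.301 (bookkeeping)] -/
theorem dentFamZ_of_ne {n M ρ : ℕ} {a : Pt P.d} {Dtop : Finset (Site P n)} {i : ℕ} (hi : i ≠ n) :
    dentFamZ P n M ρ a Dtop i = tcubeZ P.L (cornerP P M ρ a) (sideP P M ρ) ρ n := by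
  simp [dentFamZ, hi]

/-- At the top the family is `□̃ᶻ ∩` the lift. [cite: Balaban1985Variational, (150) p.301 (bookkeeping)] -/
theorem dentFamZ_top (n M ρ : ℕ) (a : Pt P.d) (Dtop : Finset (Site P n)) :
    dentFamZ P n M ρ a Dtop n = tcubeZ P.L (cornerP P M ρ a) (sideP P M ρ) ρ n ∩ liftTopZ P n Dtop := by
  simp [dentFamZ]

variable (P)

/-- ★★ **THE PRINT DATUM OF A GRID CUBE WITH THE TOP DENTED BY A LEVEL-`n` SITE SET** — the dented twin of `propCubePZ`: scale `k := n` (`1 ≤ n ≤ m + K`), corner `cornerP` (on the `ρ`-grid),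
side `sideP`, collar `ρ`; ambient family `dentFamZ` (so the dented top of (150) is `□_nᶻ ∩ liftTopZ …`); «`□̃ᶻ ⊂ Ω′_{n−1}`» by `rfl` below the top, the centred block law from
`tcubeZ_blocks_flmZ` and `liftTopZ_blocks_flmZ`. [cite: Balaban1985Variational, (144) p.300, (148)–(150) p.301; Balaban1985RegularSpaces, p.98, (1.130) p.99; Balaban1987RG1, (0.3)–(0.4) pp.252–253] -/
def recordCubePZ (n : ℕ) (hn : 1 ≤ n) (hnK : n ≤ P.m + P.K) (M ρ : ℕ) (hρ : P.L ≤ ρ) (a : Pt P.d) (Dtop : Finset (Site P n)) :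
    CubeB8DZ P.d P.L n (dentFamZ P n M ρ a Dtop) where
  k := n
  a := cornerP P M ρ a
  M := sideP P M ρ
  ρ := ρ
  one_le_k := hn
  k_le := le_rfl
  L_le_ρ := hρ
  ρ_le_M := Nat.le_mul_of_pos_right ρ (Nat.succ_pos _)
  big := by have := le_sideP (P := P) M (lt_of_lt_of_le P.L_pos hρ); omega
  L_le_dM := by
    have hd := P.hd
    have h1 : P.L ≤ sideP P M ρ := hρ.trans (Nat.le_mul_of_pos_right ρ (Nat.succ_pos _))
    calc P.L ≤ sideP P M ρ := h1
      _ = 1 * sideP P M ρ := (one_mul _).symm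
      _ ≤ P.d * sideP P M ρ := Nat.mul_le_mul_right _ hd
  tcube_sub := by
    rw [dentFamZ_of_ne (by omega : n - 1 ≠ n)]
  blocks := by
    intro x y h hx
    rw [dentFamZ_top] at hx ⊢
    exact ⟨tcubeZ_blocks_flmZ P.hL.1 (cornerP P M ρ a) (sideP P M ρ) ρ n h hx.1, liftTopZ_blocks_flmZ hnK Dtop h hx.2⟩

variable {P}

/-- The datum's scale index is `n`. [cite: Balaban1985RegularSpaces, Prop. 6 p.99 (bookkeeping)] -/
@[simp] theorem recordCubePZ_k (n : ℕ) (hn : 1 ≤ n) (hnK : n ≤ P.m + P.K) (M ρ : ℕ) (hρ : P.L ≤ ρ) (a : Pt P.d) (Dtop : Finset (Site P n)) :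
    (recordCubePZ P n hn hnK M ρ hρ a Dtop).k = n := rfl

/-- The datum's side is `sideP P M ρ`. [cite: Balaban1985RegularSpaces, (1.130) p.99 (bookkeeping)] -/
@[simp] theorem recordCubePZ_M (n : ℕ) (hn : 1 ≤ n) (hnK : n ≤ P.m + P.K) (M ρ : ℕ) (hρ : P.L ≤ ρ) (a : Pt P.d) (Dtop : Finset (Site P n)) :
    (recordCubePZ P n hn hnK M ρ hρ a Dtop).M = sideP P M ρ := rfl

/-- The datum's collar is `ρ`. [cite: Balaban1985RegularSpaces, p.98 (bookkeeping)] -/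
@[simp] theorem recordCubePZ_ρ (n : ℕ) (hn : 1 ≤ n) (hnK : n ≤ P.m + P.K) (M ρ : ℕ) (hρ : P.L ≤ ρ) (a : Pt P.d) (Dtop : Finset (Site P n)) :
    (recordCubePZ P n hn hnK M ρ hρ a Dtop).ρ = ρ := rfl

/-- The datum's corner is `cornerP P M ρ a`. [cite: Balaban1985RegularSpaces, p.98 (bookkeeping)] -/
@[simp] theorem recordCubePZ_a (n : ℕ) (hn : 1 ≤ n) (hnK : n ≤ P.m + P.K) (M ρ : ℕ) (hρ : P.L ≤ ρ) (a : Pt P.d) (Dtop : Finset (Site P n)) :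
    (recordCubePZ P n hn hnK M ρ hρ a Dtop).a = cornerP P M ρ a := rfl

/-- ★ **BELOW THE TOP THE DENTED TOWER IS THE EMPTY-DENT TOWER** ([15] (148) «`Ω′_j = □_j`, `j < k`»): `(recordCubePZ …).sq j′ = (propCubePZ …).sq j′` for `j′ < n` — every below-top
fact landed for `propCubePZ` transfers. [cite: Balaban1985Variational, (148) p.301; Balaban1985RegularSpaces, (1.131) p.99] -/
theorem recordCubePZ_sq_of_lt (n : ℕ) (hn : 1 ≤ n) (hnK : n ≤ P.m + P.K) (M ρ : ℕ) (hρ : P.L ≤ ρ) (a : Pt P.d) (Dtop : Finset (Site P n)) {j' : ℕ} (hj' : j' < n) :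
    (recordCubePZ P n hn hnK M ρ hρ a Dtop).sq j' = (propCubePZ P n hn M ρ hρ a).sq j' := by
  ext x
  simp [CubeB8DZ.sq, recordCubePZ, propCubePZ, hj'.ne]

/-- ★ **THE DENT** ([15] (150) «`Ω′_k = □_k ∩ Ω_k`»): at the top, `(recordCubePZ …).sq n = (propCubePZ …).sq n ∩ liftTopZ P n Dtop`.
[cite: Balaban1985Variational, (150) p.301; Balaban1985RegularSpaces, (1.131) p.99] -/
theorem recordCubePZ_sq_top (n : ℕ) (hn : 1 ≤ n) (hnK : n ≤ P.m + P.K) (M ρ : ℕ) (hρ : P.L ≤ ρ) (a : Pt P.d) (Dtop : Finset (Site P n)) :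
    (recordCubePZ P n hn hnK M ρ hρ a Dtop).sq n = (propCubePZ P n hn M ρ hρ a).sq n ∩ liftTopZ P n Dtop := by
  ext x
  simp only [CubeB8DZ.sq, recordCubePZ, propCubePZ, dentFamZ_top, Set.mem_inter_iff, Set.mem_setOf_eq, forall_true_left]
  tauto

end Datum

end Literature.MathematicalPhysics.QuantumFieldTheory.Balaban1983to89.Node00

end
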